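/- Free-seat work of WIDTH SEAT `ym-line-cbag-p1-w2` (prover-ym-line-cbag-p1-w2-g17-0), route `EguchiKawaiDirectionLadder`
(ideator ym-idea-2, LINE 8), crux `TripleSmallBallMargin` (stmt-QuantumFields-27724): the MARGIN DOOR — a product-form
first-link fibre bound with ANY per-pair factor obeying the two scalar envelopes `(γ, K)` implies the route's crux
`Theses.EguchiKawaiDirectionLadder.TripleSmallBallMargin` BY NAME.  An IMPLICATION (kernel-checked bookkeeping: the Weyl /
first-link reduction of `…FirstLinkWeylReduction`, the centre-symmetric pair-profile bound `centreSymmetricProfile_proof`,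
and real arithmetic); the fibre bound itself carries the random-matrix content and is NOT proved here.  Corollaries
(`ConditionalTripleBound ⇒ crux`, floored rigidity ⇒ crux) are in `…MarginDoorCorollaries`.  The route bears on the
barrier-ledger fact `EguchiKawaiBreakdown`; the Yang–Mills mass gap is NOT proved by anything in this file. -/
import Summits.QuantumFields.YangMills.Theorems.EguchiKawaiDirectionLadderFirstLinkWeylReduction
import HarnessLib

/-!
# Route `EguchiKawaiDirectionLadder`, crux `TripleSmallBallMargin`: the margin door (product-form fibre bound ⇒ crux)

Write `x_jk = |e^{iθ_j} − e^{iθ_k}|²` for the eigenvalue pairs of a diagonal first link `U 0 = diag(e^{iθ})`.  A product-form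
fibre bound with pair factor `g` (`ProductFibreBound g`, file `…FibreBoundDefs`) says that the first-link fibre of
`{S_R ≤ t}` over `diag(e^{iθ})` has `ekHaar 2 N`-measure `≤ exp(N²(C − η log t)) · ∏_{j<k} g(t, x_jk)` (`N ≥ N₀`,
`0 < t ≤ 1`, all `θ`).  The envelopes `PairFactorEnvelope g γ K`: `0 ≤ g`, (E1) `x·g(t,x) ≤ t^{1+γ}`, (E2) `x²·g(t,x) ≤ K t²`.

* `eigenangle_weight_le` — for a configuration with at least `(1 − S₀)N²/2` far increasing pairs (chordal distance `> r`):
  `∏_{j<k} x_jk · (e^{N²(C − u log t)} ∏_{j<k} g(t, x_jk)) ≤ exp(N²(e log t + C + L/2))` with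
  `e = (1+γ)(1 − 1/N⋆)/2 + (1−γ)(1−S₀)/2 − u`, `L = max(0, log(K/r²))`: every pair weighs `x·g ≤ t^{1+γ}` (E1), a far pair
  weighs `≤ K t²/r²` (E2), `#pairs = (N² − N)/2 ≥ (1 − 1/N⋆)N²/2`.
* `tripleSmallBallMargin_of_productFibreBound` — `0 < γ ≤ 1`, `0 < K`, envelopes `(γ, K)` and `ProductFibreBound g` imply the
  crux: choose `δ = ε = η = γ/16`, `N⋆ = ⌈16/γ⌉`; in `Sym_δ` the first link has pair mass `≤ S₀ = (1+δ)/2 + ε`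
  (`centreSymmetricProfile_proof`), i.e. at least `(1 − S₀)N²/2` far increasing pairs (`farPairs_ge`); the exponent is
  `e ≥ 3/4 + γ(7+γ)/64 > 3/4` (`margin_gt_three_quarters`); `t > 1` is trivial.  Rigidity alone (`γ = 0`) gives only
  `3/4 − δ/4 − ε/2`: SOME three-body surcharge is necessary, ANY power `γ > 0` suffices because `δ`, `ε` are free.
-/

set_option autoImplicit false

noncomputable section

open MeasureTheory
open scoped ENNReal Real Classical
open Literature.Barriers.QuantumFields
open Literature.LinearAlgebra.Matrix (diagonalTorusHom)

namespace Summit.QuantumFields.YangMills.Theorems.EguchiKawaiDirectionLadder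

/-! ### The weighted eigenangle product -/

/-- Exponent bookkeeping (pure real arithmetic): the four linear estimates of the margin door add up. -/
theorem margin_exponent_le {n P F F₀ ℓ lρ C u γ v S₀ L : ℝ}
    (hA1 : P * ((1 + γ) * ℓ) ≤ ((1 - v) * n / 2) * ((1 + γ) * ℓ))
    (hA2 : F * lρ ≤ F₀ * lρ) (hA3 : F₀ * lρ ≤ F₀ * (L + (1 - γ) * ℓ)) (hA4 : F₀ * L ≤ n / 2 * L)
    (hF₀ : F₀ = (1 - S₀) * n / 2) :
    n * (C - u * ℓ) + (P * ((1 + γ) * ℓ) + F * lρ) ≤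
      n * (((1 + γ) * (1 - v) / 2 + (1 - γ) * (1 - S₀) / 2 - u) * ℓ + (C + L / 2)) := by
  subst hF₀
  linarith

/-- **The eigenangle weight bound** (the heart of the door): for a centre-symmetric-profile configuration `θ` (at least
`(1 − S₀)N²/2` far increasing pairs at chordal distance `> r`), a pair factor obeying the envelopes `(γ, K)` and
`N ≥ N⋆ ≥ 1`, the Vandermonde-weighted product satisfies
`∏_{j<k} x_jk · (e^{N²(C − u log t)} ∏_{j<k} g(t,x_jk)) ≤ exp(N²(e log t + C + L/2))`,
`e = (1+γ)(1 − 1/N⋆)/2 + (1−γ)(1−S₀)/2 − u`, `L = max(0, log(K/r²))`, for `0 < t ≤ 1`. -/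
theorem eigenangle_weight_le {N Ns : ℕ} {g : ℝ → ℝ → ℝ} {γ K r S₀ C u t : ℝ} (θ : Fin N → ℝ)
    (henv : PairFactorEnvelope g γ K) (hγ : 0 ≤ γ) (hK : 0 < K) (hr : 0 < r) (ht : 0 < t) (ht1 : t ≤ 1)
    (hNs : 0 < Ns) (hNNs : Ns ≤ N) (hS₀0 : 0 ≤ 1 - S₀) (hS₀1 : 1 - S₀ ≤ 1)
    (hcount : (1 - S₀) * (N : ℝ) ^ 2 / 2 ≤
      (∑ j : Fin N, ((Finset.Ioi j).filter fun k : Fin N =>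
        ¬ ‖Complex.exp (θ j * Complex.I) - Complex.exp (θ k * Complex.I)‖ ≤ r).card : ℕ)) :
    (∏ j : Fin N, ∏ k ∈ Finset.Ioi j, ‖Complex.exp (θ j * Complex.I) - Complex.exp (θ k * Complex.I)‖ ^ 2) *
      (Real.exp ((N : ℝ) ^ 2 * (C - u * Real.log t)) *
        ∏ j : Fin N, ∏ k ∈ Finset.Ioi j,
          g t (‖Complex.exp (θ j * Complex.I) - Complex.exp (θ k * Complex.I)‖ ^ 2)) ≤
      Real.exp ((N : ℝ) ^ 2 *
        (((1 + γ) * (1 - 1 / (Ns : ℝ)) / 2 + (1 - γ) * (1 - S₀) / 2 - u) * Real.log t +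
          (C + max 0 (Real.log (K / r ^ 2)) / 2))) := by
  set f : Fin N → ℂ := fun j => Complex.exp (θ j * Complex.I) with hf
  set x : Fin N → Fin N → ℝ := fun j k => ‖f j - f k‖ ^ 2 with hx
  set far : Fin N → Fin N → Prop := fun j k => ¬ ‖f j - f k‖ ≤ r with hfar
  set F : ℕ := ∑ j : Fin N, ((Finset.Ioi j).filter (far j)).card with hF
  set F₀ : ℝ := (1 - S₀) * (N : ℝ) ^ 2 / 2 with hF₀
  set L : ℝ := max 0 (Real.log (K / r ^ 2)) with hL
  set v : ℝ := 1 / (Ns : ℝ) with hv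
  have hNs_r : (0 : ℝ) < Ns := by exact_mod_cast hNs
  have hNr : (0 : ℝ) < N := by exact_mod_cast lt_of_lt_of_le hNs hNNs
  have hL0 : 0 ≤ L := le_max_left _ _
  have hF₀0 : 0 ≤ F₀ := by positivity
  -- pair weights and their envelopes
  have hxnn : ∀ j k, 0 ≤ x j k := fun j k => by positivity
  have hx4 : ∀ j k, x j k ≤ 4 := fun j k => SpectralWindow.norm_cexp_sub_cexp_sq_le_four _ _
  set a : ℝ := t ^ (1 + γ) with ha
  have ha0 : 0 < a := Real.rpow_pos_of_pos ht _
  set b : ℝ := K * t ^ 2 / r ^ 2 with hb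
  have hb0 : 0 < b := by positivity
  set ρ : ℝ := min 1 (b / a) with hρ
  have hρ0 : 0 < ρ := lt_min one_pos (div_pos hb0 ha0)
  have hρ1 : ρ ≤ 1 := min_le_left _ _
  have hg0 : ∀ j k, 0 ≤ g t (x j k) := fun j k => (henv t (x j k) ht ht1 (hxnn j k) (hx4 j k)).1
  have hw0 : ∀ j k, 0 ≤ x j k * g t (x j k) := fun j k => mul_nonneg (hxnn j k) (hg0 j k)
  have hwa : ∀ j k, x j k * g t (x j k) ≤ a := fun j k => (henv t (x j k) ht ht1 (hxnn j k) (hx4 j k)).2.1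
  have hwb : ∀ j k, far j k → x j k * g t (x j k) ≤ a * ρ := by
    intro j k hjk
    have hrlt : r < ‖f j - f k‖ := lt_of_not_ge hjk
    have hxr : r ^ 2 ≤ x j k := by
      have := pow_le_pow_left₀ hr.le hrlt.le 2
      simpa [hx] using this
    have hE2 := (henv t (x j k) ht ht1 (hxnn j k) (hx4 j k)).2.2
    have h1 : x j k * g t (x j k) ≤ b := by
      rw [hb, le_div_iff₀ (by positivity)]
      calc x j k * g t (x j k) * r ^ 2 ≤ x j k * g t (x j k) * x j k :=
            mul_le_mul_of_nonneg_left hxr (hw0 j k)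
        _ = x j k ^ 2 * g t (x j k) := by ring
        _ ≤ K * t ^ 2 := hE2
    have hmin : a * ρ = min a b := by
      rw [hρ, mul_min_of_nonneg _ _ ha0.le, mul_one, mul_div_cancel₀ _ ha0.ne']
    rw [hmin]
    exact le_min (hwa j k) h1
  have hprod := prod_Ioi_le_pow_mul_pow (fun j k => x j k * g t (x j k)) far hw0 hwa hwb
  -- logarithms
  have hℓ0 : Real.log t ≤ 0 := Real.log_nonpos ht.le ht1
  have hPr : ((∑ j : Fin N, (Finset.Ioi j).card : ℕ) : ℝ) = ((N : ℝ) ^ 2 - N) / 2 := sum_card_Ioi_fin_real N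
  have hloga : Real.log a = (1 + γ) * Real.log t := by rw [ha, Real.log_rpow ht]
  have hlogb : Real.log b = Real.log (K / r ^ 2) + 2 * Real.log t := by
    rw [hb, show K * t ^ 2 / r ^ 2 = (K / r ^ 2) * t ^ 2 by ring,
      Real.log_mul (by positivity) (by positivity), Real.log_pow]
    push_cast; ring
  have hlogρ : Real.log ρ ≤ L + (1 - γ) * Real.log t := by
    have hLge : Real.log (K / r ^ 2) ≤ L := le_max_right _ _
    calc Real.log ρ ≤ Real.log (b / a) := Real.log_le_log hρ0 (min_le_right _ _)
      _ = Real.log b - Real.log a := Real.log_div hb0.ne' ha0.ne'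
      _ = Real.log (K / r ^ 2) + (1 - γ) * Real.log t := by rw [hlogb, hloga]; ring
      _ ≤ L + (1 - γ) * Real.log t := by linarith
  have hlogρ0 : Real.log ρ ≤ 0 := Real.log_nonpos hρ0.le hρ1
  have hexp : a ^ (∑ j : Fin N, (Finset.Ioi j).card) * ρ ^ F =
      Real.exp ((((N : ℝ) ^ 2 - N) / 2) * ((1 + γ) * Real.log t) + (F : ℝ) * Real.log ρ) := by
    rw [Real.exp_add, ← hloga, ← hPr, ← Real.log_pow, ← Real.log_pow, Real.exp_log (pow_pos ha0 _),
      Real.exp_log (pow_pos hρ0 _)]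
  -- the four linear estimates
  have hA1 : (((N : ℝ) ^ 2 - N) / 2) * ((1 + γ) * Real.log t) ≤
      ((1 - v) * (N : ℝ) ^ 2 / 2) * ((1 + γ) * Real.log t) := by
    have hneg : (1 + γ) * Real.log t ≤ 0 := mul_nonpos_of_nonneg_of_nonpos (by linarith) hℓ0
    have hNNs' : (Ns : ℝ) ≤ N := by exact_mod_cast hNNs
    have h1 : (N : ℝ) * Ns ≤ (N : ℝ) ^ 2 := by rw [sq]; exact mul_le_mul_of_nonneg_left hNNs' hNr.le
    have h2 : (N : ℝ) ≤ v * (N : ℝ) ^ 2 := by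
      rw [hv, one_div, ← div_eq_inv_mul, le_div_iff₀ hNs_r]; exact h1
    have hle : (1 - v) * (N : ℝ) ^ 2 / 2 ≤ ((N : ℝ) ^ 2 - N) / 2 := by linarith
    exact mul_le_mul_of_nonpos_right hle hneg
  have hA2 : (F : ℝ) * Real.log ρ ≤ F₀ * Real.log ρ := mul_le_mul_of_nonpos_right hcount hlogρ0
  have hA3 : F₀ * Real.log ρ ≤ F₀ * (L + (1 - γ) * Real.log t) := mul_le_mul_of_nonneg_left hlogρ hF₀0
  have hA4 : F₀ * L ≤ (N : ℝ) ^ 2 / 2 * L := by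
    refine mul_le_mul_of_nonneg_right ?_ hL0
    rw [hF₀]
    have : (1 - S₀) * (N : ℝ) ^ 2 ≤ 1 * (N : ℝ) ^ 2 := mul_le_mul_of_nonneg_right hS₀1 (by positivity)
    linarith
  have htotal := margin_exponent_le (C := C) (u := u) hA1 hA2 hA3 hA4 hF₀
  -- assemble
  have hmerge : (∏ j : Fin N, ∏ k ∈ Finset.Ioi j, x j k) * (∏ j : Fin N, ∏ k ∈ Finset.Ioi j, g t (x j k)) =
      ∏ j : Fin N, ∏ k ∈ Finset.Ioi j, (x j k * g t (x j k)) := by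
    rw [← Finset.prod_mul_distrib]
    exact Finset.prod_congr rfl fun j _ => Finset.prod_mul_distrib.symm
  have hprod' : (∏ j : Fin N, ∏ k ∈ Finset.Ioi j, x j k) * (∏ j : Fin N, ∏ k ∈ Finset.Ioi j, g t (x j k)) ≤
      Real.exp ((((N : ℝ) ^ 2 - N) / 2) * ((1 + γ) * Real.log t) + (F : ℝ) * Real.log ρ) := by
    rw [hmerge, ← hexp]; exact hprod
  calc (∏ j : Fin N, ∏ k ∈ Finset.Ioi j, x j k) *
        (Real.exp ((N : ℝ) ^ 2 * (C - u * Real.log t)) * ∏ j : Fin N, ∏ k ∈ Finset.Ioi j, g t (x j k))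
      = Real.exp ((N : ℝ) ^ 2 * (C - u * Real.log t)) *
          ((∏ j : Fin N, ∏ k ∈ Finset.Ioi j, x j k) * ∏ j : Fin N, ∏ k ∈ Finset.Ioi j, g t (x j k)) := by
        ring
    _ ≤ Real.exp ((N : ℝ) ^ 2 * (C - u * Real.log t)) *
          Real.exp ((((N : ℝ) ^ 2 - N) / 2) * ((1 + γ) * Real.log t) + (F : ℝ) * Real.log ρ) :=
        mul_le_mul_of_nonneg_left hprod' (Real.exp_pos _).le
    _ = Real.exp ((N : ℝ) ^ 2 * (C - u * Real.log t) +
          ((((N : ℝ) ^ 2 - N) / 2) * ((1 + γ) * Real.log t) + (F : ℝ) * Real.log ρ)) :=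
        (Real.exp_add _ _).symm
    _ ≤ _ := Real.exp_le_exp.mpr htotal

/-- Margin arithmetic: with `δ = ε = η = γ/16` and `1/N⋆ ≤ γ/16` the exponent exceeds `3/4` (by `≥ γ(7+γ)/64`). -/
theorem margin_gt_three_quarters {γ v : ℝ} (hγ : 0 < γ) (hv : v ≤ γ / 16) :
    (3 : ℝ) / 4 < (1 + γ) * (1 - v) / 2 + (1 - γ) * (1 - ((1 + γ / 16) / 2 + γ / 16)) / 2 - γ / 16 := by
  nlinarith [mul_le_mul_of_nonneg_left hv (by linarith : (0 : ℝ) ≤ 1 + γ), sq_nonneg γ]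

/-- **The margin door.**  If the pair factor `g` obeys the envelopes `(γ, K)` with `0 < γ ≤ 1`, `0 < K`, then the
product-form fibre bound `ProductFibreBound g` implies the route's crux `TripleSmallBallMargin` (by name), with
`δ = γ/16` and an exponent `e ≥ 3/4 + γ(7 + γ)/64 > 3/4`.  Books: Weyl + first-link Fubini
(`ekHaar_symSmallBall_le_of_eigenangle_bound`); in `Sym_δ` at least `((1−δ)/2 − ε)N²/2` unordered eigenvalue pairs of
`U 0` are far (`centreSymmetricProfile_proof` with `ε = γ/16`, `farPairs_ge`), and the Vandermonde-weighted product is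
bounded by `eigenangle_weight_le`; `t > 1` is trivial (probability `≤ 1`). -/
theorem tripleSmallBallMargin_of_productFibreBound {g : ℝ → ℝ → ℝ} {γ K : ℝ}
    (hγ : 0 < γ) (hγ1 : γ ≤ 1) (hK : 0 < K) (henv : PairFactorEnvelope g γ K) (hfb : ProductFibreBound g) :
    Summit.QuantumFields.YangMills.Theses.EguchiKawaiDirectionLadder.TripleSmallBallMargin := by
  -- parameters
  set u : ℝ := γ / 16 with hu
  have hu0 : 0 < u := by positivity
  have hu16 : u ≤ 1 / 16 := by rw [hu]; linarith
  obtain ⟨r, hr, hcsp⟩ := centreSymmetricProfile_proof u u hu0 (by linarith) hu0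
  obtain ⟨C, hC0, N₀, hfib⟩ := hfb u hu0
  set Ns : ℕ := ⌈1 / u⌉₊ with hNs
  have hNs_pos : 0 < Ns := Nat.ceil_pos.mpr (by positivity)
  have hNs_r : (0 : ℝ) < Ns := by exact_mod_cast hNs_pos
  have hNs_ge : 1 / u ≤ (Ns : ℝ) := Nat.le_ceil _
  have hinvN : 1 / (Ns : ℝ) ≤ u := by
    rw [div_le_iff₀ hNs_r]
    have h := mul_le_mul_of_nonneg_left hNs_ge hu0.le
    rw [mul_one_div_cancel hu0.ne'] at h
    linarith
  set S₀ : ℝ := (1 + u) / 2 + u with hS₀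
  have hS₀1 : 1 - S₀ ≤ 1 := by rw [hS₀]; linarith
  have hS₀0 : 0 ≤ 1 - S₀ := by rw [hS₀]; linarith
  set e : ℝ := (1 + γ) * (1 - 1 / (Ns : ℝ)) / 2 + (1 - γ) * (1 - S₀) / 2 - u with he
  set C' : ℝ := C + max 0 (Real.log (K / r ^ 2)) / 2 with hC'
  have he34 : (3 : ℝ) / 4 < e := by
    rw [he, hS₀, hu]
    exact margin_gt_three_quarters hγ (by rw [hu] at hinvN; exact hinvN)
  have he0 : 0 < e := lt_trans (by norm_num) he34
  have hC'0 : 0 ≤ C' := by have := le_max_left (0 : ℝ) (Real.log (K / r ^ 2)); rw [hC']; linarith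
  refine ⟨u, e, C', hu0, he34, max N₀ Ns, fun N hN t ht => ?_⟩
  have hNN₀ : N₀ ≤ N := le_trans (le_max_left _ _) hN
  have hNNs : Ns ≤ N := le_trans (le_max_right _ _) hN
  have hNpos : 0 < N := lt_of_lt_of_le hNs_pos hNNs
  by_cases ht1 : t ≤ 1
  swap
  · push Not at ht1
    have hlog : 0 < Real.log t := Real.log_pos ht1
    have hx : 0 ≤ (N : ℝ) ^ 2 * (e * Real.log t + C') := by positivity
    calc ekHaar 3 N (ekSymRegion 3 N u ∩ {U | ekAction U ≤ t}) ≤ 1 := prob_le_one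
      _ = ENNReal.ofReal 1 := ENNReal.ofReal_one.symm
      _ ≤ ENNReal.ofReal (Real.exp ((N : ℝ) ^ 2 * (e * Real.log t + C'))) :=
          ENNReal.ofReal_le_ofReal (Real.one_le_exp hx)
  -- the case `0 < t ≤ 1`: reduce to centre-symmetric eigenangle configurations
  refine ekHaar_symSmallBall_le_of_eigenangle_bound 2 N u t _ fun θ hθ => ?_
  have hq := hfib N hNN₀ t ht ht1 θ
  have hpm : pairMass r (diagonalTorusHom (Fin N) fun j => Circle.exp (θ j)) ≤ S₀ := hcsp N hNpos _ hθ
  rw [pairMass_diagPhases, div_le_iff₀ (by positivity)] at hpm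
  have hcount := farPairs_ge (fun j => Complex.exp (θ j * Complex.I)) hr.le hpm
  have hreal := eigenangle_weight_le (C := C) (u := u) θ henv hγ.le hK hr ht ht1 hNs_pos hNNs hS₀0 hS₀1 hcount
  have hVnn : 0 ≤ ∏ j : Fin N, ∏ k ∈ Finset.Ioi j,
      ‖Complex.exp (θ j * Complex.I) - Complex.exp (θ k * Complex.I)‖ ^ 2 :=
    Finset.prod_nonneg fun j _ => Finset.prod_nonneg fun k _ => by positivity
  calc ENNReal.ofReal (∏ j : Fin N, ∏ k ∈ Finset.Ioi j,
          ‖Complex.exp (θ j * Complex.I) - Complex.exp (θ k * Complex.I)‖ ^ 2) *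
        ekHaar 2 N {W : EKConfig 2 N |
          ekAction (Fin.cons (diagonalTorusHom (Fin N) fun j => Circle.exp (θ j)) W : EKConfig 3 N) ≤ t}
      ≤ ENNReal.ofReal (∏ j : Fin N, ∏ k ∈ Finset.Ioi j,
            ‖Complex.exp (θ j * Complex.I) - Complex.exp (θ k * Complex.I)‖ ^ 2) *
          ENNReal.ofReal (Real.exp ((N : ℝ) ^ 2 * (C - u * Real.log t)) *
            ∏ j : Fin N, ∏ k ∈ Finset.Ioi j,
              g t (‖Complex.exp (θ j * Complex.I) - Complex.exp (θ k * Complex.I)‖ ^ 2)) :=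
        mul_le_mul' le_rfl hq
    _ = ENNReal.ofReal ((∏ j : Fin N, ∏ k ∈ Finset.Ioi j,
            ‖Complex.exp (θ j * Complex.I) - Complex.exp (θ k * Complex.I)‖ ^ 2) *
          (Real.exp ((N : ℝ) ^ 2 * (C - u * Real.log t)) *
            ∏ j : Fin N, ∏ k ∈ Finset.Ioi j,
              g t (‖Complex.exp (θ j * Complex.I) - Complex.exp (θ k * Complex.I)‖ ^ 2))) :=
        (ENNReal.ofReal_mul hVnn).symm
    _ ≤ ENNReal.ofReal (Real.exp ((N : ℝ) ^ 2 * (e * Real.log t + C'))) := by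
        rw [he, hC']
        exact ENNReal.ofReal_le_ofReal hreal

end Summit.QuantumFields.YangMills.Theorems.EguchiKawaiDirectionLadder

end
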